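import Summits.KontsevichZagierPeriods.Zeta5Search.Barrier.ConeGammaPeriod
import Literature.Analysis.SpecialFunctions.DigammaGauss

/-!
# ζ(5) search — BARRIER: the exact period formula for `Φ` in DIGAMMA form

HONEST FRAMING (cell `pub-zeta5`): systematic search; no irrationality claim unless kernel-certified. MODEL objects
under Brown–Zudilin's (28)+(30) accounting ([BZ22] = arXiv:2210.03391); nothing here is a statement about `ζ(5)`;
records in print UNMOVED. Sequel of `ConeGammaPeriod` (item (P3) of `BARRIER-PLAN.md` §2b; theory seat cert-2
g17, WAKE w3 of lead/lit g23):

* `tsum_gapSeries_eq_digamma` — `Σ_{k≥0} (1/(kT+x) − 1/(kT+y)) = (ψ(y/T) − ψ(x/T))/T` for `x, y, T > 0`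
  (`ψ = Complex.digamma`, real part; from the tree's `hasSum_one_div_sub_one_div_digamma`, Andrews–Askey–Roy
  (1.2.13));
* **`phi30_eq_digammaSum`** — with STRICT breakpoints `0 = b₀ < b₁ < ⋯ < b_M = T` of one period of the orbit at
  a rational direction `a` of the closed box (`T·h_k(a) ∈ ℤ` for all 28 forms) and gap values `c_m`
  (`N_a ≡ c_m` on `(b_m, b_{m+1})`; `c₀ = 0` automatically):
  `Φ(a) = (Σ_{1≤m<M} c_m·(ψ(b_{m+1}/T) − ψ(b_m/T)))/T` — the census's `∫₀¹ N_a ψ′` (`T = 1`, integer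
  parameters; summation by parts of `Σ c_m (ψ(b_{m+1}) − ψ(b_m))`) and the lane's finite evaluation of `limΦ` at a
  rational direction (height-one units, `T = λ`), as a kernel identity GIVEN the gap data.
Not here (honest): the gap data `(b_m, c_m)` of any specific direction — a finite computation (204 breakpoints
per period at BZ's record ray, 2,750 at the N1 argmax) that the kernel does not perform in this file, so the `hΦ`
hypotheses of the record/flag/ridge pins stand.
-/

noncomputable section

open Set MeasureTheory Filter
open scoped Topology

namespace Summit.KontsevichZagierPeriods.Zeta5Search.Barrier.ConeGamma

/-- **`Σ_{k≥0} (1/(kT+x) − 1/(kT+y)) = (ψ(y/T) − ψ(x/T))/T`** for `x, y, T > 0` (`ψ = Complex.digamma`; from the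
tree's `hasSum_one_div_sub_one_div_digamma`, Andrews–Askey–Roy (1.2.13)). -/
theorem tsum_gapSeries_eq_digamma {T x y : ℝ} (hT : 0 < T) (hx : 0 < x) (hy : 0 < y) :
    ∑' k : ℕ, (1 / (k * T + x) - 1 / (k * T + y)) =
      (Complex.digamma ((y / T : ℝ) : ℂ) - Complex.digamma ((x / T : ℝ) : ℂ)).re / T := by
  have h1 := Literature.Analysis.SpecialFunctions.Complex.hasSum_one_div_sub_one_div_digamma
    (w := ((x / T : ℝ) : ℂ)) (by rw [Complex.ofReal_re]; positivity)
  have h2 := Literature.Analysis.SpecialFunctions.Complex.hasSum_one_div_sub_one_div_digamma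
    (w := ((y / T : ℝ) : ℂ)) (by rw [Complex.ofReal_re]; positivity)
  have h := h2.sub h1
  have hre := ((Complex.hasSum_iff _ _).mp h).1
  simp only [add_sub_add_right_eq_sub] at hre
  have hterm : ∀ k : ℕ, (1 / ((k : ℂ) + 1) - 1 / (((y / T : ℝ) : ℂ) + k) -
      (1 / ((k : ℂ) + 1) - 1 / (((x / T : ℝ) : ℂ) + k))).re = T * (1 / (k * T + x) - 1 / (k * T + y)) := by
    intro k
    have hxk : (x / T + k : ℝ) ≠ 0 := by positivity
    have hyk : (y / T + k : ℝ) ≠ 0 := by positivity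
    have hc : (1 / ((k : ℂ) + 1) - 1 / (((y / T : ℝ) : ℂ) + k) -
        (1 / ((k : ℂ) + 1) - 1 / (((x / T : ℝ) : ℂ) + k))) = ((1 / (x / T + k) - 1 / (y / T + k) : ℝ) : ℂ) := by
      push_cast
      ring
    rw [hc, Complex.ofReal_re]
    have hxk' : (k * T + x : ℝ) ≠ 0 := by positivity
    have hyk' : (k * T + y : ℝ) ≠ 0 := by positivity
    field_simp
    ring
  simp only [hterm] at hre
  have hdiv := hre.div_const T
  have hfun : (fun k : ℕ => T * (1 / ((k : ℝ) * T + x) - 1 / (k * T + y)) / T) =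
      fun k : ℕ => 1 / ((k : ℝ) * T + x) - 1 / (k * T + y) :=
    funext fun k => mul_div_cancel_left₀ _ hT.ne'
  rw [hfun] at hdiv
  exact hdiv.tsum_eq

/-- **EXACT PERIOD FORMULA (P3), digamma form**: with STRICT breakpoints `0 = b₀ < b₁ < ⋯ < b_M = T` of one
period and gap values `c_m`, `Φ(a) = (Σ_{1≤m<M} c_m·(ψ(b_{m+1}/T) − ψ(b_m/T)))/T` (the first gap carries `c₀ = 0`).
This is the census's `∫₀¹ N_a ψ′` (`T = 1`, integer parameters) and the lane's finite evaluation of `limΦ` at a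
rational direction of level `λ` (`T = λ` in height-one units), as a kernel identity GIVEN the gap data. -/
theorem phi30_eq_digammaSum {a : Dir} (ha : BZBox a) {T : ℝ} (hT : 0 < T)
    (hper : ∀ k : Fin 28, ∃ z : ℤ, T * h28 a k = z) {M : ℕ} {b : ℕ → ℝ} (hb0 : b 0 = 0) (hbM : b M = T)
    (hb : ∀ m < M, b m < b (m + 1)) {c : ℕ → ℤ}
    (hc : ∀ m < M, ∀ u ∈ Set.Ioo (b m) (b (m + 1)), savingN a u = c m) :
    phi30 a = (∑ m ∈ Finset.Ico 1 M, (c m : ℝ) *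
      (Complex.digamma ((b (m + 1) / T : ℝ) : ℂ) - Complex.digamma ((b m / T : ℝ) : ℂ)).re) / T := by
  have hb' : ∀ m < M, b m ≤ b (m + 1) := fun m hm => (hb m hm).le
  have hpos : ∀ m, 1 ≤ m → m ≤ M → 0 < b m := by
    intro m h1 hmM
    induction m with
    | zero => exact absurd h1 (by norm_num)
    | succ m ih =>
      rcases Nat.eq_zero_or_pos m with hm0 | hm0
      · subst hm0; have := hb 0 (by omega); rw [hb0] at this; simpa using this
      · exact (ih hm0 (by omega)).trans (hb m (by omega))
  have hM : 1 ≤ M := by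
    rcases Nat.eq_zero_or_pos M with hM0 | hM0
    · subst hM0; rw [hb0] at hbM; exact absurd hbM hT.ne
    · exact hM0
  rw [phi30_eq_sum_tsum ha hT hper hb0 hbM hb' hc, Finset.range_eq_Ico, Finset.sum_eq_sum_Ico_succ_bot hM,
    Finset.sum_div]
  have hc0 : c 0 = 0 := by
    have h01 := hb 0 (by omega)
    rw [hb0] at h01
    exact gapValue_zero_eq ha h01 (fun u hu => hc 0 (by omega) u (by rwa [hb0]))
  rw [hc0, Int.cast_zero, zero_mul, zero_add]
  refine Finset.sum_congr rfl fun m hm => ?_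
  rw [Finset.mem_Ico] at hm
  rw [tsum_gapSeries_eq_digamma hT (hpos m hm.1 hm.2.le) (hpos (m + 1) (by omega) (by omega)), mul_div_assoc]

end Summit.KontsevichZagierPeriods.Zeta5Search.Barrier.ConeGamma

end
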